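import Summits.HodgeConjecture.HodgeConjecture.Theorems.EightfoldBlochSeedsChernCharacterOnBettiAnalytificationFlag
import Summits.HodgeConjecture.HodgeConjecture.Theorems.EightfoldBlochSeedsChernCharacterOnBettiAnalytificationPullbackVectorBundle
import Literature.AlgebraicGeometry.HodgeTheory.ConiveauDescentGysinSection
import HarnessLib

/-!
# K1 → cycle law `ch_mem_algebraicClasses` for EVERY vector bundle, given a flag map with a Gysin section

Route `EightfoldBlochSeeds` / item `stmt-HodgeConjecture-19780` (`ChernCharacterOnBetti`), helper
(`--supports`). HONEST FRAMING: nothing here proves 19780 / 18880 / 18882 / 18883 / H2 / HC_AV / HC;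
no definition, no named fact.

WHAT. Grothendieck's splitting-principle reduction of the algebraicity of the Chern character, carried
out for the tree's analytification data: let `X` be smooth projective over `ℂ`, `F` a vector bundle on
`X`, and suppose given a morphism `g : Y ⟶ X` from a smooth projective `Y` of dimension `dim X + d`
such that `g^*F` has a full flag, together with a divisor class `ξ ∈ N¹ H²(Y(ℂ); ℂ)` whose `d`-th power
has Gysin push-forward `g_*(ξᵈ) = a · 1`, `a ≠ 0` — classically `Y = Fl(F)`, the complete flag bundle,
an iterated projective bundle, with `ξᵈ` the product of the powers `c₁(𝒪(1))ᵉ` of its stages (Fulton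
§3.2 and Prop. 3.1 (a): `p_*(c₁(𝒪(1))ᵉ ∩ p^*α) = α`). Then for EVERY analytification datum `(E, α)` of
`F`: `ch_k(E) ∈ algebraicClasses X k` for all `k`
(`topologicalChernCharacter_mem_algebraicClasses_of_comparison_of_flagMap`). Proof:
`g^* ch_k(E) = ch_k(E')` for a datum `E'` of `g^*F` (K1e, `topologicalChernCharacter_pullback_of_comparison`),
`ch_k(E') ∈ Nᵏ(Y)` (flagged case, `…AnalytificationFlag`), and coniveau descends along `g`
(`mem_algebraicClasses_of_map_mem_of_complexGysin_cupPowTwo_eq_smul`: `x = a⁻¹ g_*(g^*x ∪ ξᵈ)`).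
What this leaves of the field `ch_mem_algebraicClasses` (for the standard `ch` on smooth projective
`X`): the EXISTENCE of the flag bundle `Fl(F) ⟶ X` as a smooth projective `ℂ`-scheme with
`HasFullFlag (g^*F)` and the Gysin normalisation `g_*(ξᵈ) = ±1` — Grothendieck 1958 §2 / Fulton §3.2,
not in the tree (the tree's named fact `HodgeTheory.SplittingPrincipleBetti` records only the
injectivity of `g^*`).

[cite: Grothendieck1958, §2] [cite: Fulton1998, §3.1 Prop. 3.1 (a), §3.2 and Prop. 19.1.2]
[cite: Voisin2025, §4.3] [cite: SerreGAGA1956, §3 n°9 Prop. 10 and n°11]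
-/

noncomputable section

-- single-problem summit (Problem = Summit): the mandated namespace repeats `HodgeConjecture`.
set_option linter.dupNamespace false

open CategoryTheory AlgebraicGeometry Bundle Topology
open Literature.AlgebraicGeometry.Motives Literature.AlgebraicGeometry.HodgeTheory Literature.AlgebraicGeometry.Modules
open Literature.AlgebraicTopology.SingularHomology Literature.AlgebraicTopology.CharacteristicClasses

namespace Summit.HodgeConjecture.HodgeConjecture.Theorems

variable {n m d : ℕ} {X Y : SchemeOver ℂ} {F : X.left.Modules} {r : ℕ}

/-- **`ch_k(F(ℂ)) ∈ algebraicClasses X k` for every vector bundle `F` on a smooth projective `X`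
admitting a flag map with a Gysin section** (`g : Y ⟶ X` smooth projective of dimension `dim X + d`,
`g^*F` with a full flag, `ξ` a divisor class on `Y` with `g_*(ξᵈ) = a · 1`, `a ≠ 0`), for every
analytification datum `(E, α)` of `F` and every `k`. [cite: Grothendieck1958, §2]
[cite: Fulton1998, §3.1 Prop. 3.1 (a), §3.2 and Prop. 19.1.2] [cite: Voisin2025, §4.3] -/
theorem topologicalChernCharacter_mem_algebraicClasses_of_comparison_of_flagMap (hX : IsSmoothProjective n X)
    (μ : OrientationFamily) (hμ : μ.HasPoincareDuality) (hY : IsSmoothProjective m Y) (g : Y ⟶ X)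
    (hmd : n + d = m) {ξ : complexBetti Y 2} (hξ : ξ ∈ algebraicClasses Y 1) {a : ℂ} (ha : a ≠ 0)
    (hone : complexGysin μ hY hX g (show 2 * d + 2 * n = 0 + 2 * m by omega) (cupPowTwo ξ d) =
      a • singularCohomology.one ℂ (ComplexPoints X))
    (hF : IsVectorBundle F) (hflag : HasFullFlag ((Scheme.Modules.pullback g.left).obj F))
    (hFr : ∀ x : X.left, ∃ (U : X.left.Opens) (s : Fin r → Γ(F, U)), x ∈ U ∧ IsSectionFrame F U s)
    (E : ComplexVectorBundle.{0, 0} (ComplexPoints X))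
    (α : ∀ U : X.left.Opens, Γ(F, U) → ∀ P : ComplexPoints X, E.E P)
    (hadd : ∀ (U : X.left.Opens) (σ τ : Γ(F, U)) (P : ComplexPoints X), α U (σ + τ) P = α U σ P + α U τ P)
    (hsmul : ∀ (U : X.left.Opens) (f : Γ(X.left, U)) (σ : Γ(F, U)) (P : ComplexPoints X) (h : P.pt ∈ U),
      α U (f • σ) P = P.eval U h f • α U σ P)
    (hres : ∀ (U W : X.left.Opens) (hWU : W ≤ U) (σ : Γ(F, U)) (P : ComplexPoints X), P.pt ∈ W →
      α W (F.presheaf.map (homOfLE hWU).op σ) P = α U σ P)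
    (hcont : ∀ (U : X.left.Opens) (σ : Γ(F, U)),
      ContinuousOn (fun P ↦ (⟨P, α U σ P⟩ : TotalSpace E.F E.E)) {P | P.pt ∈ U})
    (hframe : ∀ (U : X.left.Opens) (t : Fin r → Γ(F, U)), IsSectionFrame F U t →
      ∀ P : ComplexPoints X, P.pt ∈ U → LinearIndependent ℂ (fun j ↦ α U (t j) P) ∧
        ⊤ ≤ Submodule.span ℂ (Set.range fun j ↦ α U (t j) P)) (k : ℕ) :
    theChernClassTheory.topologicalChernCharacter ℂ E k ∈ algebraicClasses X k := by
  haveI := IsSmoothProjective.isIntegral_holds hX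
  haveI := IsSmoothProjective.isIntegral_holds hY
  -- trivialisations of one size and a datum of `g^*F`
  obtain ⟨r₀, hFr₀⟩ := exists_free_fin_iso_of_isVectorBundle hF
  have hF' : IsVectorBundle ((Scheme.Modules.pullback g.left).obj F) :=
    ((isFiniteLocallyFree_of_isVectorBundle hF).pullback g.left).isVectorBundle
  obtain ⟨r', E', α', -, hfr', hadd', hsmul', hres', hcont', hframe'⟩ :=
    exists_topologicalAnalytification_of_isVectorBundle hY hF'
  obtain ⟨x₀⟩ := (inferInstance : Nonempty X.left)
  obtain rfl : r = r₀ := by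
    obtain ⟨U, e, hx⟩ := hFr₀ x₀
    obtain ⟨U₁, s₁, hx₁, hs₁⟩ := hFr x₀
    exact frame_card_eq hs₁ (isSectionFrame_basisSection e (Equiv.refl _)) hx₁ hx
  obtain ⟨y₀⟩ := (inferInstance : Nonempty Y.left)
  obtain rfl : r' = r := by
    obtain ⟨U, e, hx⟩ := hFr₀ (g.left.base y₀)
    obtain ⟨U₂, s₂, hy₂, hs₂⟩ := hfr' y₀
    exact frame_card_eq hs₂ (isSectionFrame_unitSection g e (Equiv.refl _)) hy₂ hx
  -- `g^* ch_k(E) = ch_k(E')`, `ch_k(E')` is algebraic (flag), and coniveau descends along `g`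
  have hpull := topologicalChernCharacter_pullback_of_comparison g hX hY hFr₀ E E' α α' hadd hsmul hres hcont hframe
    hadd' hsmul' hres' hcont' hframe' k
  have hY' := topologicalChernCharacter_mem_algebraicClasses_of_comparison_of_hasFullFlag hY hflag hfr' E' α'
    hadd' hsmul' hres' hcont' hframe' k
  refine mem_algebraicClasses_of_map_mem_of_complexGysin_cupPowTwo_eq_smul μ hμ hY hX g hmd hξ ha hone ?_
  rw [hpull]
  exact hY'

end Summit.HodgeConjecture.HodgeConjecture.Theorems

end
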